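import Summits.RiemannHypothesis.RiemannHypothesis.Theorems.SemilocalNegCertSeventyOneKinked2150PiecesA
import Summits.RiemannHypothesis.RiemannHypothesis.Theorems.SemilocalNegCertSeventyOneKinked2150PiecesB
import Summits.RiemannHypothesis.RiemannHypothesis.Theorems.HandoffLadderRungOne
import Summits.RiemannHypothesis.RiemannHypothesis.Theorems.HandoffUpperClausesC
import Summits.RiemannHypothesis.RiemannHypothesis.Theorems.SemilocalClassLaw
import Summits.RiemannHypothesis.RiemannHypothesis.Theorems.SemilocalLogAtomsF
import HarnessLib

/-!
# Semi-local threshold of the `{∞,2,…,71}` form, negative side: `a*({2,…,71}) ≤ 1101 / 512 = 2.150390625` — the wall `q = 73` from a KINKED (piecewise-cubic) witness with slope breaks at the prime-atom images (part 31/31: the composition of the piece facts and the THEOREMS)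

Cell `rh-explicit` (HOME `run/shared/lean/pub/rh-explicit/`), seat cc-s2-9 gen3 (HUMAN RULING D-0074 (D5) WEIL data engine; LADDER-RH column WEIL, rung DATA → W-P(P2);
pipeline = cc-s2-4 gen8/gen11's piecewise-witness layer `SemilocalPiecewise{Witness,Increment,IncrementSum,Cert}.lean` + their float finder, every number
re-derived by an independent second engine E2 before filing; gen0/gen2 rows: `SemilocalNegCert{ThirteenKinked1423,…,FiftyThreeKinked2044}*`, capstone `SemilocalKinkedWallOffsets`).
HONEST FRAMING: RH-FREE theorems about the tree's `weilSemilocalThreshold S` of a TRUNCATED Weil form (finitely many places); nothing here bears on the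
truth of RH; the lower clause `(log q)/2 ≤ a*(S_q)` at all primes IS RH and is untouched; the SIGN of `δ*(73)` is not claimed.

KINKED row for the wall `q = 73` (`S = {2,…,71}`): at `b = 1101 / 512 = 2.150390625 ≈ a*(S_73) + 0.0051` (DATA, two engines, cc-s2-6/cc-s2-3: `a*(S_73) = 2.1452531`)
the polynomial × indicator class is far from negative (tree row `139/64`, `SemilocalNegCertUptoSeventyOne`, `δ*(73) ≤ 0.0266`), whereas an odd piecewise cubic with slope breaks at the images
`|b − log n|` (rounded to `/1024`) of the atoms `n ∈ {3,5,7,11,13,17,19,23,29,31,37,41,43,47,53,59,61,67,71}` (the odd-prime atoms; all atom images resp. all primes resp. primes + 4 + 9 scanned, kit j257393) is negative by `5.808e-03·‖G‖²`.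
Instance: `S = {2, 3, 5, 7, 11, 13, 17, 19, 23, 29, 31, 37, 41, 43, 47, 53, 59, 61, 67, 71}`, `N = 77` (atom table `atomsUptoSeventyOne` / `atomsEnclose_UptoSeventyOne` of `SemilocalNegCertUptoSeventyOne.lean`), 20 pieces of degree ≤ 3, 415 `t`-pieces;
TWO ENGINES on the witness before the kernel: cc-s2-4's float finder `λ_min = -5.8079e-03` and the seat's exact-in-`x` decimal engine E2 `R = -5.8116e-03` (no polar credit);
the exact kernel margin is the certificate's own rational arithmetic (farm report).  ⇒ **`a*({2,…,71}) ≤ 1101 / 512`, `δ*(73) < 0.005161`** (was `0.0266`).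
No data is trusted: every bound is a `decide +kernel` fact.  Folklore throughout.
-/

set_option autoImplicit false
set_option linter.dupNamespace false  -- the mandated namespace repeats `RiemannHypothesis`
set_option Elab.async false  -- serialise the kernel facts: in parallel they exhaust the node's per-process heap (cc-s2-4 gen11, CC4-LEAN §16.10)

noncomputable section

open Complex Filter Set MeasureTheory Topology
open scoped Real

namespace Summit.RiemannHypothesis.RiemannHypothesis.Theorems.SemilocalPolyWitness

open MeasureTheory Set Finset Real
open Literature.NumberTheory.LFunctions
open Summit.RiemannHypothesis.RiemannHypothesis.Theorems.MotivicDoor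
open Summit.RiemannHypothesis.RiemannHypothesis.Theorems.MotivicDoor.SemilocalThreshold
open Summit.RiemannHypothesis.RiemannHypothesis.Theorems.MotivicDoor.SemilocalMarkov
open LQ

set_option maxRecDepth 4000 in  -- `i < cuts.length` unfolds a 415-element list
/-- all 415 pieces of `certSeventyOneKinked2150` check (the two half-range compositions `check_SeventyOneKinked2150_piecesA/B`). -/
theorem check_SeventyOneKinked2150_pieces : ∀ i, i < certSeventyOneKinked2150.cuts.length → certSeventyOneKinked2150.checkPiecePW i = true := by
  intro i hi
  have hi' : i < 415 := hi
  by_cases h : i < 207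
  · exact check_SeventyOneKinked2150_piecesA i h
  · exact check_SeventyOneKinked2150_piecesB i (Nat.not_lt.mp h) hi'

/-! ### The theorems -/

open Summit.RiemannHypothesis.RiemannHypothesis.Theorems.HandoffMarginLaw (wallOffset)

/-- **`a*(2,…,71) ≤ 1101 / 512 = 2.150390625`** — the wall `q = 73` from the KINKED witness (the tree's polynomial row:
`139/64`, `SemilocalNegCertUptoSeventyOne`). RH-free. -/
theorem weilSemilocalThreshold_uptoSeventyOne_le_2150 :
    weilSemilocalThreshold {2, 3, 5, 7, 11, 13, 17, 19, 23, 29, 31, 37, 41, 43, 47, 53, 59, 61, 67, 71} ≤ ((1101 / 512 : ℚ) : ℝ) :=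
  weilSemilocalThreshold_le_of_checkPW_sharp certSeventyOneKinked2150 atomsEnclose_UptoSeventyOne
    check_SeventyOneKinked2150_main check_SeventyOneKinked2150_atoms check_SeventyOneKinked2150_pieces

/-- Failure form: positivity of the `{∞,2,…,71}` form fails on every cone `C(B)`, `B > 1101 / 512`. -/
theorem not_weilSemilocalPositivityOn_uptoSeventyOne_of_gt_2150 {B : ℝ} (hB : (1101 / 512 : ℝ) < B) :
    ¬ WeilSemilocalPositivityOn {2, 3, 5, 7, 11, 13, 17, 19, 23, 29, 31, 37, 41, 43, 47, 53, 59, 61, 67, 71} B := by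
  rw [not_weilSemilocalPositivityOn_iff_weilSemilocalThreshold_lt]
  have h := weilSemilocalThreshold_uptoSeventyOne_le_2150
  push_cast at h
  linarith

/-- **`a*(S) ≤ 1101 / 512` for every finite `S` of least missing prime `73`** (`{p < 73} ⊆ S ∌ 73`; the class of `73`, by first-gap locality
`SemilocalClassLaw.weilSemilocalThreshold_eq_of_classLawAt'` at the PROVED instance `semilocalClassLawAt_seventythree`). -/
theorem weilSemilocalThreshold_le_2150_of_mem {S : Finset ℕ} (hS : ∀ p : ℕ, p.Prime → p < 73 → p ∈ S) (h73 : 73 ∉ S) :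
    weilSemilocalThreshold S ≤ ((1101 / 512 : ℚ) : ℝ) := by
  rw [SemilocalClassLaw.weilSemilocalThreshold_eq_of_classLawAt' (by norm_num) hS h73 SemilocalClassLaw.semilocalClassLawAt_seventythree,
    HandoffUpperClauses.primesBelow_seventythree]
  exact weilSemilocalThreshold_uptoSeventyOne_le_2150

/-- `a*(S_73) ≤ 1101 / 512` in the `Nat.primesBelow` currency of the handoff / class-law files. -/
theorem weilSemilocalThreshold_primesBelow_seventythree_le_2150 :
    weilSemilocalThreshold (Nat.primesBelow 73) ≤ ((1101 / 512 : ℚ) : ℝ) := by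
  rw [HandoffUpperClauses.primesBelow_seventythree]
  exact weilSemilocalThreshold_uptoSeventyOne_le_2150

/-- **Two-sided KERNEL bracket of the class of `73`**: `1 ≤ a*(S) ≤ 1101 / 512` for every finite `S` with `{p < 73} ⊆ S ∌ 73`
(lower end: the `a = 1` rung through locality, `HandoffLadderRungOne.one_le_wall_of_ge_eight`; DATA `a*(S_73) = 2.1452531`). RH-free. -/
theorem weilSemilocalThreshold_mem_Icc_one_2150 {S : Finset ℕ} (hS : ∀ p : ℕ, p.Prime → p < 73 → p ∈ S) (h73 : 73 ∉ S) :
    weilSemilocalThreshold S ∈ Set.Icc (1 : ℝ) ((1101 / 512 : ℚ) : ℝ) := by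
  rw [SemilocalClassLaw.weilSemilocalThreshold_eq_of_classLawAt' (by norm_num) hS h73 SemilocalClassLaw.semilocalClassLawAt_seventythree]
  exact ⟨HandoffLadderRungOne.one_le_wall_of_ge_eight (N := 73) (by norm_num), weilSemilocalThreshold_primesBelow_seventythree_le_2150⟩

/-- **The wall offset in the kernel**: `δ*(73) = a*(S_73) − (log 73)/2 ≤ 1101 / 512 − (log 73)/2` (the polynomial row gave `139/64 − (log 73)/2`).
RH-free; the SIGN of `δ*(73)` is not claimed here. -/
theorem wallOffset_seventythree_le_2150 : wallOffset 73 ≤ 1101 / 512 - Real.log 73 / 2 := by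
  have h := weilSemilocalThreshold_uptoSeventyOne_le_2150
  push_cast at h
  rw [wallOffset, HandoffUpperClauses.primesBelow_seventythree]
  push_cast
  linarith

/-- … numerically: **`δ*(73) < 0.005161`** (the tree's polynomial row: `0.0266`; DATA, two engines: `δ*(73) ≈ 2.3e-05`). RH-free. -/
theorem wallOffset_seventythree_lt_005161 : wallOffset 73 < 0.005161 := by
  have h := wallOffset_seventythree_le_2150
  have hl := log_seventythree_gt
  linarith

end Summit.RiemannHypothesis.RiemannHypothesis.Theorems.SemilocalPolyWitness

end
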